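import Literature.Computability.AlgebraicComplexity.AlmanLi2026SpectrumMatMul
import Literature.Computability.AlgebraicComplexity.RectangularExponentHomogeneity
import Literature.Computability.AlgebraicComplexity.RectangularExponentAlpha
import Literature.Computability.AlgebraicComplexity.Coppersmith1982RapidRectangular
import HarnessLib

/-!
# Route `FarEdgeDescent` — Kernel XXI-A «spectral shadow»: the far-edge profile is the support function of the spectrum

decomp-mm ROOT cell (D-0178), lens 2 «structural dichotomy: special vs generic», gen 45.  Node of record
UNCHANGED: `closes (h₁ : FiniteSaturation) (h₂ : AnchoredLogConvexity) : MatrixMultiplication`.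
THESES-FREE by construction (critic g44 lint debt): this module imports `Literature` only; the route's
item texts appear INLINE (never by name), so nothing here enters a `Theses` cone.  Every statement holds
over an ARBITRARY field `K`.  Companion: `FarEdgeDescentSpectralHorn` (the horn, the generic crux on the
spectrum, top isolation).

The objects.  For a universal spectral point `φ` over `K` write `θ = specMMPoint K φ ∈ [0,1]³`
(Alman–Li 2026, Prop. 4.1: `φ⟨n,m,p⟩ = n^{θ₁} m^{θ₂} p^{θ₃}`), its DARKNESS `d(φ) = θ₁+θ₂+θ₃ − 2 ≥ 0`,
its DEPTH `ε(φ) = 1 − θ₂` and HEIGHT `θ₂`; `f(x) = ω_K(1,x,1)`, `e(x) = f(x) − (x+1)`.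

§1 SUPPORT FUNCTION ON THE REAL PENCIL (gen 12 `FarEdgeDescentSpectralEdge.isGreatest_twoPow` is the
   natural-format, multiplicative statement; here: rational formats, the whole real pencil, additive
   coordinates).  `log₂ φ⟨2^a,2^b,2^c⟩ = aθ₁+bθ₂+cθ₃`; `(aθ₁+bθ₂+cθ₃)/d ≤ ω(a/d,b/d,c/d)` with equality for
   some `φ` (Strassen duality + homogeneity); for EVERY REAL `x ≥ 0`, `θ₁ + xθ₂ + θ₃ ≤ f(x)`, and `f(x)` is
   the least upper bound of these affine SPECTRAL LINES (`isLUB_line`).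
§2 THE SHADOW CRITERIA.  `f(x) = x+1 ⟺ ∀φ, d(φ) ≤ (x−1)·ε(φ)` and `f(x) = 2 ⟺ ∀φ, d(φ) ≤ (1−x)·θ₂(φ)`
   (`x ≥ 0`): far saturation at `x` says the shadow `{(ε(φ), d(φ))}` lies under the CONE of slope `x−1`
   through the edge `ε = 0`; the near plateau at `x` says it lies under the cone of slope `1−x` in the
   height.  Hence `ω_K = 2 ⟺` no dark point; the special crux's text `∃k≥2, f(k)=k+1 ⟺` a far cone; and —
   PROVED regime, every field — the near cone `d ≤ (1−α_K)θ₂ ≤ 0.8278·θ₂` (Coppersmith's `α > 0.1722`):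
   dark points have positive height.  The summit is «both cones close up at `x = 1`».

NO definitions (gate rule D-0009): `d`, `ε`, lines and shapes are written out.  Nothing here proves `ω = 2`.
-/

set_option linter.dupNamespace false

noncomputable section

open scoped BigOperators

namespace Summit.MatrixMultiplication.MatrixMultiplication.Theorems.FarEdgeDescentSpectralShadow

open Literature.Computability.AlgebraicComplexity

variable {K : Type} [Field K]

/-! ## §1 The support function of the spectrum on rational formats and on the real middle pencil -/

/-- **Additive coordinates on power-of-two formats**: `log₂ φ⟨2^a,2^b,2^c⟩ = aθ₁ + bθ₂ + cθ₃`.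
[cite: AlmanLi2026, Proposition 4.1] -/
theorem logb_map_twoPow {F : SpectralMap K} (hF : IsUniversalSpectralPoint K F) (a b c : ℕ) :
    Real.logb 2 (F (matMulTensor K (2 ^ a) (2 ^ b) (2 ^ c))) =
      a * specMMPoint K F 0 + b * specMMPoint K F 1 + c * specMMPoint K F 2 := by
  have h := AlmanLi2026.prop41 hF (n := 2 ^ a) (m := 2 ^ b) (p := 2 ^ c)
    Nat.one_le_two_pow Nat.one_le_two_pow Nat.one_le_two_pow
  have e : ∀ (j : ℕ) (t : ℝ), (((2 ^ j : ℕ) : ℝ)) ^ t = (2 : ℝ) ^ ((j : ℝ) * t) := by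
    intro j t
    rw [Nat.cast_pow, Nat.cast_ofNat, ← Real.rpow_natCast,
      ← Real.rpow_mul (by norm_num : (0 : ℝ) ≤ 2)]
  rw [h, e, e, e, ← Real.rpow_add two_pos, ← Real.rpow_add two_pos,
    Real.logb_rpow two_pos (by norm_num)]

/-- The value of a spectral point on a positive format is positive. [cite: AlmanLi2026, Proposition 4.2] -/
theorem map_twoPow_pos {F : SpectralMap K} (hF : IsUniversalSpectralPoint K F) (a b c : ℕ) :
    0 < F (matMulTensor K (2 ^ a) (2 ^ b) (2 ^ c)) :=
  lt_of_lt_of_le one_pos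
    (hF.one_le_map_matMulTensor Nat.one_le_two_pow Nat.one_le_two_pow Nat.one_le_two_pow)

/-- **Homogeneity on rational formats**: `ω(a/d, b/d, c/d) = ω(a,b,c)/d` (`d ≥ 1`).
[cite: LottiRomani1983, §2 (p. 174)] -/
theorem omegaRect_div (a b c : ℕ) {d : ℕ} (hd : 1 ≤ d) :
    omegaRect K ((a : ℝ) / d) ((b : ℝ) / d) ((c : ℝ) / d) = omegaRect K a b c / d := by
  have hdpos : (0 : ℝ) < d := by exact_mod_cast (by omega : 0 < d)
  have h := omegaRect_smul K hd (a := (a : ℝ) / d) (b := (b : ℝ) / d) (c := (c : ℝ) / d)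
    (by positivity) (by positivity) (by positivity)
  rw [mul_div_cancel₀ _ hdpos.ne', mul_div_cancel₀ _ hdpos.ne', mul_div_cancel₀ _ hdpos.ne'] at h
  rw [h]
  field_simp

/-- **`ω(a/d,b/d,c/d) = log₂ R̃⟨2^a,2^b,2^c⟩ / d`** (`d ≥ 1`): the rational exponents through the
asymptotic rank. [cite: AlmanDuanVassilevskaWilliamsXuXuZhou2025, §3.4] -/
theorem omegaRect_div_eq_logb (a b c : ℕ) {d : ℕ} (hd : 1 ≤ d) :
    omegaRect K ((a : ℝ) / d) ((b : ℝ) / d) ((c : ℝ) / d) =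
      Real.logb 2 (asymptoticRank (matMulTensor K (2 ^ a) (2 ^ b) (2 ^ c))) / d := by
  rw [omegaRect_div a b c hd, advxxz2025_omegaRect_eq_logb_asymptoticRank K le_rfl a b c]
  norm_num

/-- **Every spectral line lies below the exponent on rational formats**:
`(aθ₁ + bθ₂ + cθ₃)/d ≤ ω(a/d, b/d, c/d)` — the easy half of Strassen duality, `φ⟨2^a,2^b,2^c⟩ ≤
R̃⟨2^a,2^b,2^c⟩ = 2^{ω(a,b,c)}`, and homogeneity. [cite: Strassen1988, Thm. 3.8]
[cite: ChristandlVranaZuiddam2023, Prop. 1.6] -/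
theorem line_le_omegaRect_div {F : SpectralMap K} (hF : IsUniversalSpectralPoint K F) (a b c : ℕ)
    {d : ℕ} (hd : 1 ≤ d) :
    (a * specMMPoint K F 0 + b * specMMPoint K F 1 + c * specMMPoint K F 2) / d ≤
      omegaRect K ((a : ℝ) / d) ((b : ℝ) / d) ((c : ℝ) / d) := by
  have hdpos : (0 : ℝ) < d := by exact_mod_cast (by omega : 0 < d)
  rw [omegaRect_div_eq_logb a b c hd, ← logb_map_twoPow hF a b c]
  refine div_le_div_of_nonneg_right ?_ hdpos.le
  exact Real.logb_le_logb_of_le one_lt_two (map_twoPow_pos hF a b c)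
    ((strassen_duality_asymptoticRank_holds K (matMulTensor K (2 ^ a) (2 ^ b) (2 ^ c))).1 F hF)

/-- **Every rational format is CARRIED**: some universal spectral point attains
`(aθ₁ + bθ₂ + cθ₃)/d = ω(a/d, b/d, c/d)` (the hard half of Strassen duality, `R̃ = max_φ φ`).
[cite: Strassen1988, Thm. 3.8] [cite: ChristandlVranaZuiddam2023, Prop. 1.6] -/
theorem exists_carrier_div (a b c : ℕ) {d : ℕ} (hd : 1 ≤ d) :
    ∃ F : SpectralMap K, IsUniversalSpectralPoint K F ∧
      (a * specMMPoint K F 0 + b * specMMPoint K F 1 + c * specMMPoint K F 2) / d =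
        omegaRect K ((a : ℝ) / d) ((b : ℝ) / d) ((c : ℝ) / d) := by
  obtain ⟨F, hF, hFt⟩ :=
    (strassen_duality_asymptoticRank_holds K (matMulTensor K (2 ^ a) (2 ^ b) (2 ^ c))).2
  refine ⟨F, hF, ?_⟩
  rw [omegaRect_div_eq_logb a b c hd, ← hFt, logb_map_twoPow hF a b c]

/-- The middle pencil at a rational point: `θ₁ + (p/d)θ₂ + θ₃ ≤ ω(1, p/d, 1)`. [cite: Strassen1988, Thm. 3.8] -/
theorem line_le_omegaRect_one_rat_one {F : SpectralMap K} (hF : IsUniversalSpectralPoint K F) (p : ℕ)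
    {d : ℕ} (hd : 1 ≤ d) :
    specMMPoint K F 0 + (p : ℝ) / d * specMMPoint K F 1 + specMMPoint K F 2 ≤
      omegaRect K 1 ((p : ℝ) / d) 1 := by
  have hdpos : (0 : ℝ) < d := by exact_mod_cast (by omega : 0 < d)
  have h := line_le_omegaRect_div hF d p d hd
  rw [div_self hdpos.ne'] at h
  have e : ((d : ℝ) * specMMPoint K F 0 + p * specMMPoint K F 1 + d * specMMPoint K F 2) / d =
      specMMPoint K F 0 + (p : ℝ) / d * specMMPoint K F 1 + specMMPoint K F 2 := by
    field_simp
  rwa [e] at h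

/-- Every rational point of the middle pencil is carried: `θ₁ + (p/d)θ₂ + θ₃ = ω(1, p/d, 1)` for some
universal spectral point. [cite: Strassen1988, Thm. 3.8] -/
theorem exists_carrier_one_rat_one (p : ℕ) {d : ℕ} (hd : 1 ≤ d) :
    ∃ F : SpectralMap K, IsUniversalSpectralPoint K F ∧
      specMMPoint K F 0 + (p : ℝ) / d * specMMPoint K F 1 + specMMPoint K F 2 =
        omegaRect K 1 ((p : ℝ) / d) 1 := by
  have hdpos : (0 : ℝ) < d := by exact_mod_cast (by omega : 0 < d)
  obtain ⟨F, hF, h⟩ := exists_carrier_div (K := K) d p d hd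
  refine ⟨F, hF, ?_⟩
  rw [div_self hdpos.ne'] at h
  have e : ((d : ℝ) * specMMPoint K F 0 + p * specMMPoint K F 1 + d * specMMPoint K F 2) / d =
      specMMPoint K F 0 + (p : ℝ) / d * specMMPoint K F 1 + specMMPoint K F 2 := by
    field_simp
  rwa [e] at h

/-- **The spectral lines lie below the profile on the whole REAL pencil**: for every real `x ≥ 0` and
every universal spectral point, `θ₁ + x·θ₂ + θ₃ ≤ ω(1, x, 1)` (rational approximation from above,
`θ₂ ≥ 0`, and the `1`-Lipschitz estimate `ω(1,p,1) ≤ ω(1,q,1) + (p − q)`). [cite: Strassen1988, Thm. 3.8]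
[cite: ChristandlLeGallLysikovZuiddam2025, Rem. 3.13] -/
theorem line_le_omegaRect {F : SpectralMap K} (hF : IsUniversalSpectralPoint K F) {x : ℝ} (hx : 0 ≤ x) :
    specMMPoint K F 0 + x * specMMPoint K F 1 + specMMPoint K F 2 ≤ omegaRect K 1 x 1 := by
  have hθ := (AlmanLi2026.prop42_mem_Icc hF 1).1
  refine le_of_forall_pos_lt_add fun δ hδ => ?_
  obtain ⟨d, hd⟩ := exists_nat_one_div_lt hδ
  set D : ℕ := d + 1 with hD
  have hD1 : 1 ≤ D := by omega
  have hDpos : (0 : ℝ) < D := by exact_mod_cast (by omega : 0 < D)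
  set p : ℕ := ⌊x * D⌋₊ + 1 with hp
  -- `x < p/D ≤ x + 1/D`
  have hxp : x ≤ (p : ℝ) / D := by
    rw [le_div_iff₀ hDpos, hp]
    push_cast
    exact (Nat.lt_floor_add_one (x * D)).le
  have hpx : (p : ℝ) / D ≤ x + 1 / D := by
    rw [div_le_iff₀ hDpos, hp, add_mul, one_div_mul_cancel hDpos.ne']
    push_cast
    have := Nat.floor_le (mul_nonneg hx hDpos.le)
    linarith
  have h1 := line_le_omegaRect_one_rat_one hF p hD1
  have h2 := omegaRect_one_mid_one_le_add K hxp
  have h3 : x * specMMPoint K F 1 ≤ (p : ℝ) / D * specMMPoint K F 1 :=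
    mul_le_mul_of_nonneg_right hxp hθ
  have h4 : (1 : ℝ) / D = 1 / ((d : ℝ) + 1) := by rw [hD]; push_cast; ring
  linarith

/-- **The profile is the least upper bound of the spectral lines** at every real `x ≥ 0`:
`ω(1,x,1) = sup_φ (θ₁ + xθ₂ + θ₃)` — the far-edge profile is the support function of `specMM` along the
pencil `(1,x,1)` (upper bound: `line_le_omegaRect`; sharpness: carriers of rational `p/d ↑ x` and
Lipschitz continuity). [cite: Strassen1988, Thm. 3.8] [cite: AlmanLi2026, Proposition 4.1] -/
theorem isLUB_line {x : ℝ} (hx : 0 ≤ x) :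
    IsLUB ((fun F : SpectralMap K => specMMPoint K F 0 + x * specMMPoint K F 1 + specMMPoint K F 2) ''
        {F | IsUniversalSpectralPoint K F}) (omegaRect K 1 x 1) := by
  refine ⟨?_, ?_⟩
  · rintro _ ⟨F, hF, rfl⟩
    exact line_le_omegaRect hF hx
  · intro b hb
    refine le_of_forall_pos_lt_add fun δ hδ => ?_
    obtain ⟨d, hd⟩ := exists_nat_one_div_lt hδ
    set D : ℕ := d + 1 with hD
    have hD1 : 1 ≤ D := by omega
    have hDpos : (0 : ℝ) < D := by exact_mod_cast (by omega : 0 < D)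
    set p : ℕ := ⌊x * D⌋₊ with hp
    -- `p/D ≤ x < p/D + 1/D`
    have hpx : (p : ℝ) / D ≤ x := by
      rw [div_le_iff₀ hDpos, hp]
      exact Nat.floor_le (mul_nonneg hx hDpos.le)
    have hxp : x ≤ (p : ℝ) / D + 1 / D := by
      rw [← add_div, le_div_iff₀ hDpos, hp]
      exact (Nat.lt_floor_add_one (x * D)).le
    obtain ⟨F, hF, hcar⟩ := exists_carrier_one_rat_one (K := K) p hD1
    have hθ := (AlmanLi2026.prop42_mem_Icc hF 1).1
    have hbF : specMMPoint K F 0 + x * specMMPoint K F 1 + specMMPoint K F 2 ≤ b := hb ⟨F, hF, rfl⟩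
    have h2 := omegaRect_one_mid_one_le_add K hpx
    have h3 : (p : ℝ) / D * specMMPoint K F 1 ≤ x * specMMPoint K F 1 :=
      mul_le_mul_of_nonneg_right hpx hθ
    have h4 : (1 : ℝ) / D = 1 / ((d : ℝ) + 1) := by rw [hD]; push_cast; ring
    linarith


/-! ## §2 The shadow criteria: cones at both edges -/

/-- `θ₁ + θ₂ + θ₃` over `Fin 3`. [folklore] -/
theorem sum_three (F : SpectralMap K) :
    ∑ i, specMMPoint K F i = specMMPoint K F 0 + specMMPoint K F 1 + specMMPoint K F 2 := by
  rw [Fin.sum_univ_three]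

/-- **Far saturation is a cone over the edge**: for real `x ≥ 0`,
`ω(1,x,1) = x + 1 ⟺` every universal spectral point has darkness `d = θ₁+θ₂+θ₃−2 ≤ (x−1)·(1−θ₂)`
(depth `1−θ₂`).  At a natural `x = k` this is the spectral reading of «`ω(1,k,1) = k+1`»; at `x = 1` it is
«`ω = 2 ⟺` no dark point». [cite: Strassen1988, Thm. 3.8] [cite: LottiRomani1983, §2 (p. 174)] -/
theorem saturated_iff_farCone {x : ℝ} (hx : 0 ≤ x) :
    omegaRect K 1 x 1 = x + 1 ↔
      ∀ F : SpectralMap K, IsUniversalSpectralPoint K F →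
        (∑ i, specMMPoint K F i) - 2 ≤ (x - 1) * (1 - specMMPoint K F 1) := by
  constructor
  · intro h F hF
    have hl := line_le_omegaRect hF hx
    rw [h] at hl
    have e : (x - 1) * (1 - specMMPoint K F 1) = x - 1 - x * specMMPoint K F 1 + specMMPoint K F 1 := by
      ring
    rw [sum_three, e]
    linarith
  · intro h
    refine le_antisymm ?_ (add_one_le_omegaRect_one_mid_one K x)
    refine (isLUB_line hx).2 ?_
    rintro _ ⟨F, hF, rfl⟩
    have hF' := h F hF
    have e : (x - 1) * (1 - specMMPoint K F 1) = x - 1 - x * specMMPoint K F 1 + specMMPoint K F 1 := by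
      ring
    rw [sum_three, e] at hF'
    show specMMPoint K F 0 + x * specMMPoint K F 1 + specMMPoint K F 2 ≤ x + 1
    linarith

/-- **The near plateau is a cone over the origin**: for real `x ≥ 0`,
`ω(1,x,1) = 2 ⟺` every universal spectral point has darkness `d ≤ (1−x)·θ₂` (height `θ₂`).
[cite: Strassen1988, Thm. 3.8] [cite: Coppersmith1982, Thm. 1] -/
theorem plateau_iff_nearCone {x : ℝ} (hx : 0 ≤ x) :
    omegaRect K 1 x 1 = 2 ↔
      ∀ F : SpectralMap K, IsUniversalSpectralPoint K F →
        (∑ i, specMMPoint K F i) - 2 ≤ (1 - x) * specMMPoint K F 1 := by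
  constructor
  · intro h F hF
    have hl := line_le_omegaRect hF hx
    rw [h] at hl
    have e : (1 - x) * specMMPoint K F 1 = specMMPoint K F 1 - x * specMMPoint K F 1 := by ring
    rw [sum_three, e]
    linarith
  · intro h
    refine le_antisymm ?_ (two_le_omegaRect_one_mid_one K x)
    refine (isLUB_line hx).2 ?_
    rintro _ ⟨F, hF, rfl⟩
    have hF' := h F hF
    have e : (1 - x) * specMMPoint K F 1 = specMMPoint K F 1 - x * specMMPoint K F 1 := by ring
    rw [sum_three, e] at hF'
    show specMMPoint K F 0 + x * specMMPoint K F 1 + specMMPoint K F 2 ≤ 2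
    linarith

/-- **The summit text on the spectrum, every field: `ω_K = 2 ⟺` no dark point** (`θ₁+θ₂+θ₃ ≤ 2`, hence
`= 2`, for every universal spectral point) — both cones degenerate to the light plane at `x = 1`.
[cite: AlmanLi2026, Proposition 4.2] -/
theorem omega_eq_two_iff_noDark :
    omega K = 2 ↔ ∀ F : SpectralMap K, IsUniversalSpectralPoint K F → ∑ i, specMMPoint K F i ≤ 2 := by
  rw [← omegaRect_one_one_one K, plateau_iff_nearCone (K := K) zero_le_one]
  refine forall_congr' fun F => forall_congr' fun _ => ?_
  constructor <;> intro h <;> linarith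

/-- **The special crux's text is a far CONE**: `(∃ k ≥ 2, ω(1,k,1) = k+1) ⟺ ∃ k ≥ 2, ∀φ, d(φ) ≤ (k−1)·ε(φ)`
— the shadow `{(1−θ₂, θ₁+θ₂+θ₃−2)}` of the spectrum lies under a cone of finite slope through the edge.
[cite: LottiRomani1983, Prop. 4.1] [cite: Strassen1988, Thm. 3.8] -/
theorem finiteSaturationShape_iff_cone :
    (∃ k : ℕ, 2 ≤ k ∧ omegaRect K 1 k 1 = k + 1) ↔
      ∃ k : ℕ, 2 ≤ k ∧ ∀ F : SpectralMap K, IsUniversalSpectralPoint K F →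
        (∑ i, specMMPoint K F i) - 2 ≤ ((k : ℝ) - 1) * (1 - specMMPoint K F 1) :=
  exists_congr fun k => and_congr Iff.rfl (saturated_iff_farCone (K := K) (Nat.cast_nonneg k))

/-- **The near cone is a THEOREM** (every field): for `0 ≤ x ≤ α_K` every universal spectral point has
`d ≤ (1−x)·θ₂` (`ω(1,x,1) = 2` on `[0, α]`). [cite: Coppersmith1982, Thm. 1] [cite: LeGallUrrutia2018, §1] -/
theorem darkness_le_nearCone {F : SpectralMap K} (hF : IsUniversalSpectralPoint K F) {x : ℝ} (hx : 0 ≤ x)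
    (hxα : x ≤ dualExponentAlpha K) :
    (∑ i, specMMPoint K F i) - 2 ≤ (1 - x) * specMMPoint K F 1 :=
  (plateau_iff_nearCone hx).1 (omegaRect_eq_two_of_le_dualExponentAlpha K hxα) F hF

/-- Coppersmith's constant: **`d(φ) ≤ 0.8278·θ₂(φ)`** for every universal spectral point over every field
(`α_K > 0.1722`). [cite: Coppersmith1982, Thm. 1] -/
theorem darkness_le_coppersmith {F : SpectralMap K} (hF : IsUniversalSpectralPoint K F) :
    (∑ i, specMMPoint K F i) - 2 ≤ 0.8278 * specMMPoint K F 1 := by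
  have h := darkness_le_nearCone hF (by norm_num : (0 : ℝ) ≤ 0.1722)
    (coppersmith1982_dualExponentAlpha_gt K).le
  norm_num at h ⊢
  linarith

/-- **Dark points have positive height**: `θ₁+θ₂+θ₃ > 2 ⟹ θ₂ > 0` — no dark point on the face `θ₂ = 0`
(every field). [cite: Coppersmith1982, Thm. 1] -/
theorem height_pos_of_dark {F : SpectralMap K} (hF : IsUniversalSpectralPoint K F)
    (hd : 2 < ∑ i, specMMPoint K F i) : 0 < specMMPoint K F 1 := by
  have h := darkness_le_coppersmith hF
  have h0 := (AlmanLi2026.prop42_mem_Icc hF 1).1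
  rcases h0.lt_or_eq with hpos | hzero
  · exact hpos
  · rw [← hzero] at h
    linarith

end Summit.MatrixMultiplication.MatrixMultiplication.Theorems.FarEdgeDescentSpectralShadow

end
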